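import Mathlib
import HarnessLib
import Summits.AtomisticToContinuum.Statement
import Literature.Analysis.FluidPDE.HardSphereCollisionRecord
import Summits.AtomisticToContinuum.HydrodynamicLimit.Theses.OneFlightGossipEngine

/-!
# Sketch (crux-ideate k=2 on stmt-AtomisticToContinuum-17700, BandCoherenceLDAlongFamilies)

The crux as typed is refuted in mathematics by the Galilean-boost witness (refuter rattack-17700-0,
re-derived in `Negative-notes/boost-witness-and-repair.md`).  This file only records, as
ELABORATING candidate signatures over existing declarations, the two repairs analysed in that memo
(for the route-repair / tenure planner; nothing here is filed as an item by this seat):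

* `KineticCurrentsLDAlongFamiliesQ` — the docking node KCWF (stmt-16659) with the tilt threshold made
  UNIFORM over the normalised class (`∃ β₀` moved in front of `∀ (A, b, G)`, growth constant `C`
  entering as `|β| * C ≤ β₀`).  Its instance `F = (b·w) R χ_{K₁}(|w|²)` (growth constant `∝ K₁`) is the
  signed, collision-invariant-orthogonal BAND heat-flux remainder at tilt `∝ 1/K₁` — the
  Nachtergaele–Yau shape `|p|³ 1{|p| ≤ M} ≤ M p²`, Grönwall constant `∝ M`.
* `BandRemainderLDAlongFamilies` — the same instance written out stand-alone (what would replace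
  BandCoherenceLDAlongFamilies 1 : 1 in `clampedTransferDock_of_inputs` if KCWF is left untouched).
* `boost_lower_bound_shape` — the elementary real inequality behind the witness' positivity
  (sup over the drift `D` of `λ·(5D) − D²/2 = 12.5 λ²` at `D = 5λ`), kernel-checked.
-/

namespace Summit.AtomisticToContinuum.HydrodynamicLimit.Cruxes.BandCoherenceLDAlongFamilies.IdeatorTwo

open scoped BigOperators
open MeasureTheory Set Function
open Literature.MathematicalPhysics.KineticTheory Literature.Analysis.FluidPDE

/-- CANDIDATE REPAIR (R1): quantitative docking node — KCWF with a class-uniform tilt threshold.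
Differs from `OneFlightGossipEngine.KineticCurrentsLDAlongFamilies` (stmt-16659) only in the position of
`∃ β₀` (now before the weights `A, b, G`) and in the normalisation `|β| * C ≤ β₀`. -/
def KineticCurrentsLDAlongFamiliesQ : Prop :=
  ∃ η₀ : ℝ, 0 < η₀ ∧ ∀ (t₁ : ℝ) (a θ₀ : ℝ → T3 → ℝ) (u₀ : ℝ → T3 → V3),
    Continuous (Function.uncurry a) → Continuous (Function.uncurry θ₀) → Continuous (Function.uncurry u₀) →
    (∀ s x, 0 < a s x) → (∀ s x, 0 < θ₀ s x) → ∀ σ : ℝ, 0 < σ →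
    (∀ s ∈ Set.Icc 0 t₁, σ ^ 3 * (⨆ x, a s x) ≤ η₀ * ∫ x, a s x) →
    ∀ Φ : (N : ℕ) → HardSphereFlow (Torus.geometry (Fin 3)) (hsDiameter σ N) (N + 1),
    ∃ β₀ : ℝ, 0 < β₀ ∧
    ∀ (A : ℝ → T3 → Fin 3 → Fin 3 → ℝ) (b : ℝ → T3 → V3) (G : ℝ → T3 × ℝ → ℝ),
    Continuous (Function.uncurry A) → Continuous (Function.uncurry b) → Continuous (Function.uncurry G) →
    (let F := fun (s : ℝ) (y : T3 × V3) =>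
        (∑ j : Fin 3, ∑ k : Fin 3, A s y.1 j k * ((y.2 - u₀ s y.1) j * (y.2 - u₀ s y.1) k)) +
          (∑ j : Fin 3, b s y.1 j * (y.2 - u₀ s y.1) j) * G s (y.1, ‖y.2 - u₀ s y.1‖ ^ 2)
     ∀ C : ℝ, 0 < C → (∀ s ∈ Set.Icc 0 t₁, ∀ y : T3 × V3, |F s y| ≤ C * (1 + ‖y.2‖ ^ 2)) →
     (∀ s ∈ Set.Icc 0 t₁, ∀ x, ∫ v, F s (x, v) * localMaxwellian 1 (θ₀ s x) (u₀ s x) v = 0) →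
     (∀ s ∈ Set.Icc 0 t₁, ∀ x (j : Fin 3), ∫ v, F s (x, v) * v j * localMaxwellian 1 (θ₀ s x) (u₀ s x) v = 0) →
     (∀ s ∈ Set.Icc 0 t₁, ∀ x, ∫ v, F s (x, v) * ‖v‖ ^ 2 * localMaxwellian 1 (θ₀ s x) (u₀ s x) v = 0) →
     ∀ β : ℝ, |β| * C ≤ β₀ → ∀ ε : ℝ, 0 < ε → ∃ τ₀ : ℝ, 0 < τ₀ ∧ ∀ τ : ℝ, τ₀ ≤ τ →
     ∃ N₀ : ℕ, ∀ N : ℕ, N₀ ≤ N → ∀ s ∈ Set.Icc 0 t₁,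
       ∫⁻ z, ENNReal.ofReal (Real.exp (β * ∑ i : Fin (N + 1),
           (τ * ((N : ℝ) + 1) ^ (-(1 / 3 : ℝ)))⁻¹ *
             ∫ r in (0 : ℝ)..(τ * ((N : ℝ) + 1) ^ (-(1 / 3 : ℝ))), F s ((Φ N).flow r z i)))
         ∂(localGibbsLaw σ (a s) (u₀ s) (θ₀ s) N (Φ N)) ≤ ENNReal.ofReal (Real.exp (ε * ((N : ℝ) + 1))))

/-- CANDIDATE REPAIR (R1, stand-alone form): the SIGNED band heat-flux remainder window LD at the
K₁-scaled tilt.  `b` = the coefficient field (∇θ/(2θ²) in the dock), `R` = continuous radial weight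
vanishing below `K⋆²`, supported in `|w| ≤ K₁ + 1`, `|R| ≤ |s'|`, orthogonal to `|w|²` under the local
Maxwellian (the only collision-invariant condition not automatic for an odd functional). -/
def BandRemainderLDAlongFamilies : Prop :=
  ∃ η₀ : ℝ, 0 < η₀ ∧ ∀ (t₁ Θbar : ℝ) (a θ₀ : ℝ → T3 → ℝ) (u₀ : ℝ → T3 → V3),
    Continuous (Function.uncurry a) → Continuous (Function.uncurry θ₀) → Continuous (Function.uncurry u₀) →
    (∀ s x, 0 < a s x) → (∀ s x, 0 < θ₀ s x) → (∀ s ∈ Set.Icc 0 t₁, ∀ x, θ₀ s x ≤ Θbar) →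
    (∀ s ∈ Set.Icc 0 t₁, ∀ x, ‖u₀ s x‖ ≤ Θbar) →
    ∀ σ : ℝ, 0 < σ → (∀ s ∈ Set.Icc 0 t₁, σ ^ 3 * (⨆ x, a s x) ≤ η₀ * ∫ x, a s x) →
    ∀ Φ : (N : ℕ) → HardSphereFlow (Torus.geometry (Fin 3)) (hsDiameter σ N) (N + 1),
    ∃ β₀ : ℝ, 0 < β₀ ∧ ∀ Kstar K₁ : ℝ, 0 < Kstar → Kstar ≤ K₁ →
    ∀ (b : ℝ → T3 → V3) (R : ℝ → T3 → ℝ → ℝ), Continuous (Function.uncurry b) →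
    Continuous (fun p : ℝ × T3 × ℝ => R p.1 p.2.1 p.2.2) →
    (∀ s x, ‖b s x‖ ≤ 1) → (∀ s x s', s' ≤ Kstar ^ 2 → R s x s' = 0) →
    (∀ s x s', (K₁ + 1) ^ 2 ≤ s' → R s x s' = 0) → (∀ s x s', |R s x s'| ≤ |s'|) →
    (∀ s ∈ Set.Icc 0 t₁, ∀ x, ∫ w : V3, ‖w‖ ^ 2 * R s x (‖w‖ ^ 2) * localMaxwellian 1 (θ₀ s x) 0 w = 0) →
    ∀ β : ℝ, |β| * K₁ ≤ β₀ → ∀ ε : ℝ, 0 < ε → ∃ τ₀ : ℝ, 0 < τ₀ ∧ ∀ τ : ℝ, τ₀ ≤ τ →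
    ∃ N₀ : ℕ, ∀ N : ℕ, N₀ ≤ N → ∀ s ∈ Set.Icc 0 t₁,
      (let w : ℝ := τ * ((N : ℝ) + 1) ^ (-(1 / 3 : ℝ))
       let P := localGibbsLaw σ (a s) (u₀ s) (θ₀ s) N (Φ N)
       let W := fun (i : Fin (N + 1)) (r : ℝ) (z : Config (N + 1) (Fin 3) T3) =>
         ((Φ N).flow r z i).2 - u₀ s ((Φ N).flow r z i).1
       let F := fun (i : Fin (N + 1)) (r : ℝ) (z : Config (N + 1) (Fin 3) T3) =>
         (∑ j : Fin 3, b s ((Φ N).flow r z i).1 j * W i r z j) * R s ((Φ N).flow r z i).1 (‖W i r z‖ ^ 2)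
       ∫⁻ z, ENNReal.ofReal (Real.exp (β * ∑ i : Fin (N + 1), w⁻¹ * ∫ r in (0 : ℝ)..w, F i r z)) ∂P ≤
         ENNReal.ofReal (Real.exp (ε * ((N : ℝ) + 1))))

/-- The elementary optimisation behind the boost witness: at linear response `γ(D) = c·D` and entropy
cost `D²/(2θ)` per particle, the drift `D = c θ lam` gives the per-particle pressure lower bound
`lam·γ(D) − D²/(2θ) = c² θ lam² / 2 > 0` for every fixed tilt `lam > 0` (with `c = 5`, `θ = 1`:
`12.5 lam²`). -/
theorem boost_lower_bound_shape (c θ lam : ℝ) (hθ : 0 < θ) (hc : c ≠ 0) (hlam : 0 < lam) :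
    0 < lam * (c * (c * θ * lam)) - (c * θ * lam) ^ 2 / (2 * θ) := by
  have h1 : lam * (c * (c * θ * lam)) - (c * θ * lam) ^ 2 / (2 * θ) = c ^ 2 * θ * lam ^ 2 / 2 := by
    field_simp
    ring
  rw [h1]
  have hc2 : 0 < c ^ 2 := by positivity
  positivity

/-- Sanity: the refuted crux and the two candidates are distinct propositions syntactically; the
candidates are NOT claimed to imply the crux (which is false). This `example` only checks that the
route decl is in scope under its full name. -/
example : Summit.AtomisticToContinuum.HydrodynamicLimit.Theses.OneFlightGossipEngine.BandCoherenceLDAlongFamilies →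
    Summit.AtomisticToContinuum.HydrodynamicLimit.Theses.OneFlightGossipEngine.BandCoherenceLDAlongFamilies :=
  id

end Summit.AtomisticToContinuum.HydrodynamicLimit.Cruxes.BandCoherenceLDAlongFamilies.IdeatorTwo
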